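import Literature.NumberTheory.EllipticCurves.KleinFrickeLevelThirteen
import Literature.NumberTheory.EllipticCurves.KleinFrickeLevelsTwoThree
import HarnessLib

/-!
# Route `IsogenyGlueCongruence`, crux `KenkuPrintedLevels` (stmt-ABC-18224), conjunct (ii), level `26`:
# REDUCTION of "no cyclic rational `26`-isogeny" to the Klein–Fricke `2 × 13` fibre product

`Summits/ABC/ABC/Theorems/IsogenyGlueCongruenceKenkuPrintedLevelsLevelTwentySix.lean` — unit
`abc-inputs-pr-1` (KEY KENKU26, INPUTS-LIST row I-07/26; progress on the open residue of Kenku's theorem,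
not closure). PROOFS ONLY (0 definitions, 0 named facts stated; ONE named fact CONSUMED by name as a
hypothesis: `Literature.NumberTheory.EllipticCurves.kleinFrickeThirteen_exists_j_eq`, Klein–Fricke at
level `13`, cite-only, typed ≠ proved).

Level `26 = 2 · 13` is one of the levels of conjunct (ii) of `KenkuPrintedLevels` (`Y₀(N)(ℚ) = ∅` for
`N ∈ {26, 35, 65, 125, 169}`; `X₀(26)` has genus `2` and its rational points are its four cusps —
Mazur–Swinnerton-Dyer / Ogg, used by Kenku [cite: Kenku1982, Thm. 1 and its proof, pp. 199–201]). This
file is the level-`26` twin of `…KenkuPrintedLevelsLevelThirtyFive.lean` (level `35 = 5 · 7`): the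
tree PROVES Klein–Fricke at level `2` over any field of characteristic `0`
(`Isogeny.exists_j_eq_klein_two_of_two_dvd_degree`: a cyclic isogeny of even degree forces
`j = (s + 16)³/s`, `s ≠ 0`), and Klein–Fricke at level `13` is the named fact
`kleinFrickeThirteen_exists_j_eq` (a degree-`13` isogeny forces
`j = (t² + 5t + 13)(t⁴ + 7t³ + 20t² + 19t + 1)³/t`, `t ≠ 0`). Hence (this file):

* `exists_kleinTwo_kleinThirteen_of_isCyclic_degree_twentySix` — granted the level-`13` fact, a
  cyclic rational `26`-isogeny out of `V` produces a rational point `(s, t)`, `s t ≠ 0`, of the fibre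
  product `X₀(2) ×_{X(1)} X₀(13)` (irreducible, birational to `X₀(26)`:
  `[Γ(1) : Γ₀(2) ∩ Γ₀(13)] = 42 = 3 · 14`), in the affine model
  `C₂₆ : (s + 16)³ · t = (t² + 5t + 13)(t⁴ + 7t³ + 20t² + 19t + 1)³ · s`,
  both sides being `j(V) · s · t`;
* `isCyclic_degree_ne_twentySix_of_points` — **level `26` of conjunct (ii) REDUCED**, modulo the
  level-`13` fact, to the explicit Diophantine statement `D₂₆` (displayed hypothesis `hPts`): the
  affine curve `C₂₆` has no rational point with `s t ≠ 0`. (`D₂₆` is TRUE: a rational `t` forces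
  `j ∉ {0, 1728}` — the factors `t² + 5t + 13`, `t⁴ + 7t³ + 20t² + 19t + 1`, `t² + 6t + 13` and the
  sextic of `j − 1728` have no rational root — so every such point is a smooth point of the fibre
  product and lifts to a non-cuspidal rational point of `X₀(26)`, of which there is none. Its
  kernel certificate — the Hauptmodul of `X₀(26)/w₂₆` as a rational function of `(s, t)`, the
  genus-`2` model, an elliptic quotient of rank `0` in Cremona's class `26a` and its Mordell–Weil
  group — is the business of the companion file `KenkuLevelTwentySixCertificate.lean`, NOT of this one.)
* `isCyclic_degree_ne_twentySix_of_no_common_j` — the same with `D₂₆` phrased through the common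
  value `j`.

HONESTY: an INPUTS→UNCONDITIONAL step at abc distance 0; with `hPts` discharged, level `26` becomes
PROVED MODULO ONE CITE-ONLY FACT (`kleinFrickeThirteen_exists_j_eq`), not proved; `KenkuPrintedLevels`
(stmt-ABC-18224) is NOT closed by this file; no summit, rung or item is proved; abc moved by 0; NOT abc.
-/

-- `Summit.ABC.ABC` is the mandated summit-side namespace (CONVENTIONS §2); the duplicate is deliberate.
set_option linter.dupNamespace false

noncomputable section
open WeierstrassCurve
open Literature.NumberTheory.EllipticCurves

namespace Summit.ABC.ABC.Theorems

/-! ### A cyclic `26`-isogeny gives a rational point of the `2 × 13` fibre product -/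

/-- **A cyclic rational `26`-isogeny gives a non-cuspidal rational point of `X₀(2) ×_{X(1)} X₀(13)`**
(modulo Klein–Fricke at level `13`). If `ψ : V → V'` is a cyclic `ℚ`-isogeny of degree `26` and the
level-`13` fact `kleinFrickeThirteen_exists_j_eq` is granted, there are `s, t ∈ ℚˣ` with
`j(V) = (s + 16)³/s = (t² + 5t + 13)(t⁴ + 7t³ + 20t² + 19t + 1)³/t`; in particular
`(s + 16)³ · t = (t² + 5t + 13)(t⁴ + 7t³ + 20t² + 19t + 1)³ · s`. Klein–Fricke at `2` on the cyclic
degree-`2` quotient (`Isogeny.exists_j_eq_klein_two_of_two_dvd_degree`, PROVED), Klein–Fricke at `13`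
(the hypothesis `h13`) on the cyclic degree-`13` quotient (`Isogeny.exists_isCyclic_degree_eq_of_dvd`).
[cite: Kenku1982, proof of Thm. 1, pp. 200–201] [cite: SilvermanAEC2009, III.4.11, III.4.12] -/
theorem exists_kleinTwo_kleinThirteen_of_isCyclic_degree_twentySix
    (h13 : kleinFrickeThirteen_exists_j_eq)
    (V V' : WeierstrassCurve ℚ) [V.IsElliptic] [V'.IsElliptic] (ψ : Isogeny V V')
    (hψ : ψ.IsCyclic) (hdeg : ψ.degree = 26) :
    ∃ s t : ℚ, s ≠ 0 ∧ t ≠ 0 ∧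
      V.j = (s + 16) ^ 3 / s ∧
      V.j = (t ^ 2 + 5 * t + 13) * (t ^ 4 + 7 * t ^ 3 + 20 * t ^ 2 + 19 * t + 1) ^ 3 / t ∧
      (s + 16) ^ 3 * t = (t ^ 2 + 5 * t + 13) * (t ^ 4 + 7 * t ^ 3 + 20 * t ^ 2 + 19 * t + 1) ^ 3 * s := by
  obtain ⟨s, hs0, hjs⟩ :=
    ψ.exists_j_eq_klein_two_of_two_dvd_degree hψ (hdeg ▸ (by norm_num : (2 : ℕ) ∣ 26))
  obtain ⟨V₁₃, hV₁₃, ψ₁₃, -, hψ₁₃d, -⟩ :=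
    ψ.exists_isCyclic_degree_eq_of_dvd hψ (d := 13) (hdeg ▸ (by norm_num : (13 : ℕ) ∣ 26))
  haveI := hV₁₃
  obtain ⟨t, ht0, hjt⟩ := h13 ψ₁₃ hψ₁₃d
  have hjs' : V.j * s = (s + 16) ^ 3 := by
    rw [hjs]; field_simp
  have hjt' : V.j * t = (t ^ 2 + 5 * t + 13) * (t ^ 4 + 7 * t ^ 3 + 20 * t ^ 2 + 19 * t + 1) ^ 3 := by
    rw [hjt]; field_simp
  refine ⟨s, t, hs0, ht0, hjs, hjt, ?_⟩
  linear_combination s * hjt' - t * hjs'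

/-! ### Level `26` reduced to the Diophantine statement `D₂₆` -/

/-- **Level `26` of `KenkuPrintedLevels` (ii), reduced to the fibre product** (modulo Klein–Fricke at
level `13`). Displayed hypotheses: `h13` — the cite-only named fact `kleinFrickeThirteen_exists_j_eq`;
`hPts` — `D₂₆`: the affine curve
`C₂₆ : (s + 16)³ · t = (t² + 5t + 13)(t⁴ + 7t³ + 20t² + 19t + 1)³ · s` (the Klein–Fricke `2 × 13`
fibre product, birational to the genus-`2` curve `X₀(26)`) has no rational point with `s t ≠ 0` (the
rational points of `X₀(26)` are its four cusps — Mazur–Swinnerton-Dyer / Ogg; NOT proved here). Then no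
elliptic curve over `ℚ` admits a cyclic `ℚ`-isogeny of degree `26`.
[cite: Kenku1982, Thm. 1 and its proof, pp. 199–201] -/
theorem isCyclic_degree_ne_twentySix_of_points
    (h13 : kleinFrickeThirteen_exists_j_eq)
    (hPts : ∀ s t : ℚ, s ≠ 0 → t ≠ 0 →
      (s + 16) ^ 3 * t ≠ (t ^ 2 + 5 * t + 13) * (t ^ 4 + 7 * t ^ 3 + 20 * t ^ 2 + 19 * t + 1) ^ 3 * s)
    (V V' : WeierstrassCurve ℚ) [V.IsElliptic] [V'.IsElliptic] (ψ : Isogeny V V')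
    (hψ : ψ.IsCyclic) : ψ.degree ≠ 26 := fun hdeg ↦ by
  obtain ⟨s, t, hs0, ht0, -, -, hrel⟩ :=
    exists_kleinTwo_kleinThirteen_of_isCyclic_degree_twentySix h13 V V' ψ hψ hdeg
  exact hPts s t hs0 ht0 hrel

/-- The same reduction with `D₂₆` written through the common value `j`: granted Klein–Fricke at level
`13`, it suffices that no `j ∈ ℚ` is simultaneously of the form `(s + 16)³/s` and
`(t² + 5t + 13)(t⁴ + 7t³ + 20t² + 19t + 1)³/t` with `s, t ∈ ℚˣ`.
[cite: Kenku1982, Thm. 1 and its proof, pp. 199–201] -/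
theorem isCyclic_degree_ne_twentySix_of_no_common_j
    (h13 : kleinFrickeThirteen_exists_j_eq)
    (hPts : ∀ j s t : ℚ, s ≠ 0 → t ≠ 0 → j = (s + 16) ^ 3 / s →
      j ≠ (t ^ 2 + 5 * t + 13) * (t ^ 4 + 7 * t ^ 3 + 20 * t ^ 2 + 19 * t + 1) ^ 3 / t)
    (V V' : WeierstrassCurve ℚ) [V.IsElliptic] [V'.IsElliptic] (ψ : Isogeny V V')
    (hψ : ψ.IsCyclic) : ψ.degree ≠ 26 := fun hdeg ↦ by
  obtain ⟨s, t, hs0, ht0, hjs, hjt, -⟩ :=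
    exists_kleinTwo_kleinThirteen_of_isCyclic_degree_twentySix h13 V V' ψ hψ hdeg
  exact hPts V.j s t hs0 ht0 hjs hjt

end Summit.ABC.ABC.Theorems

end
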